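import Summits.HubbardSuperconductivity.HubbardSuperconductivity.Theorems.ThermalWedgeTwSourcedInertnessSusceptibility

/-!
# Route `ThermalWedge`, crux `TwSourcedCondensation` (item `stmt-HubbardSuperconductivity-1697`):
# the engine's disc slack (A) in SUSCEPTIBILITY FORM

`--supports stmt-HubbardSuperconductivity-1697` file of the line lead (continuation seat c1, line
`entropy-staircase-linear-regime`); no definition, no `sorry`, no named fact.

The engine statement `E = (A) ∧ (B)` of `ThermalWedgeTwSourcedCondensationEngineReduction` closes both
constructive cruxes of the route. Its pair-source half (A) is a TWO-SIDED bound on the interaction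
correction to the sourced pressure gain, `D_L(β,h) = [p̃_U(h) − p̃_0(h)] − [p̃_U(0) − p̃_0(0)]`,
`|D_L(β,h)| ≤ (η log β + K)h²` on the disc `|h| ≤ κ/β`. A renormalisation-group construction does not
deliver `D_L` but RESPONSE FUNCTIONS: the Kubo–Mori–Bogoliubov `d`-wave pair susceptibility of the
sourced torus Gibbs state, `χ_L(β,u,μ,t) = (β/L²)[Re (Q,Q)_{β,H} − (Re⟨Q⟩_{β,H})²]`,
`H = dWaveSourceTorus L u μ t`, `Q = Δ_d + Δ_d†` — which is `∂²_t p̃_L` (Dyson–Lieb–Simon 1978 eq. (5);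
tree: `hasDerivAt_re_gibbsState_source`, and `hasDerivAt_log_partitionFn_source` below). This file
proves the bridge (every finite torus, then quantified):

* `hasDerivAt_log_partitionFn_source` — `d/dt log Z_β(H − tA) = β Re⟨A⟩_{H−tA}` (abstract);
* `abs_gainCorrection_le_of_varDiff_le` — (abstract, Hermitian `H₁, H₂, A`, `⟨A⟩_{H₁} = ⟨A⟩_{H₂} = 0`)
  if the KMB variances of `A` along the two sourced families differ by at most `v` for `|t| ≤ |h|`,
  then `|[log Z(H₁ − hA) − log Z(H₁)] − [log Z(H₂ − hA) − log Z(H₂)]| ≤ β² v h²` (two mean value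
  theorems: the difference `D` has `D(0) = D'(0) = 0`, `|D''| ≤ β² v`);
* `tw_discSlack_of_susceptibilityDiff_le` — on the torus: `|χ_L(β,U,μ,t) − χ_L(β,0,μ,t)| ≤ M` for
  `|t| ≤ |h|` gives `|D_L(β,h)| ≤ M h²`;
* `stub_engineDiscSlack_of_susceptibilitySlack` — the quantified form: the SUSCEPTIBILITY SLACK
  "(A_χ) `∃ κ ∀ η ∃ U₀ a K`: `|χ_L(β,U,μ,t) − χ_L(β,0,μ,t)| ≤ η log β + K` for `|t| ≤ κ/β`, `0 < U ≤ U₀`,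
  `1 ≤ β ≤ e^{a/U}`, `μ ∈ [μ₁,μ₂]`, eventually in `L`" implies the registered engine stub
  `stub_engineDiscSlack` (A) VERBATIM (same `κ, U₀, a, K`). So (A) may be read as the textbook
  four-point statement "the interacting and the free `d`-wave pair susceptibilities of the torus at
  `T ≥ e^{−a/U}` agree up to `o(log β)` throughout the thermal disc" — the Cooper-bubble sector of the
  missing sourced expansion, and nothing more.

Sources: F. J. Dyson, E. H. Lieb, B. Simon, J. Stat. Phys. 18 (1978) 335, §3 eq. (5) [DLS1978];
G. Benfatto, A. Giuliani, V. Mastropietro, Ann. Henri Poincaré 7 (2006) 809, Thm 1.1 and Remark 2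
[BenfattoGiulianiMastropietro2006]. Tree: `hasDerivAt_re_gibbsState_source`,
`hasDerivAt_re_trace_exp_add_smul`, `gibbsWeight_sub_smul`, `partitionFn_re_pos`,
`gibbsState_hubbardTorusWith_pairSource`, `isHermitian_pairField_add_conjTranspose`.
-/

noncomputable section

namespace Summit.HubbardSuperconductivity.HubbardSuperconductivity.Theorems

open Matrix Finset Literature.MathematicalPhysics.QuantumLattice
open Summit.HubbardSuperconductivity.HubbardSuperconductivity.Theorems.TwSourcedCondensation.Negative
open scoped Matrix.Norms.L2Operator ComplexOrder

/-! ### Abstract: the pressure along a source is C², with second derivative the KMB variance -/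

section Abstract

variable {m : Type*} [Fintype m] [DecidableEq m]

/-- **`d/dt log Z_β(H − tA) = β Re⟨A⟩_{H − tA}`** for Hermitian `H`, `A`, `β > 0`.
[cite: DLS1978, §3 eq. (5)] -/
theorem hasDerivAt_log_partitionFn_source {H A : Matrix m m ℂ} (hH : H.IsHermitian)
    (hA : A.IsHermitian) [Nonempty m] {β : ℝ} (hβ : 0 < β) (s : ℝ) :
    HasDerivAt (fun t : ℝ => Real.log (partitionFn β (H - (t : ℂ) • A)).re)
      (β * (gibbsState β (H - (s : ℂ) • A) A).re) s := by
  have hβ0 : β ≠ 0 := hβ.ne'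
  set 𝔄 : Matrix m m ℂ := -(β : ℂ) • H with h𝔄
  set Y : Matrix m m ℂ := (β : ℂ) • A with hY
  set Z : ℝ → ℝ := fun t => (NormedSpace.exp (𝔄 + t • Y)).trace.re with hZdef
  set N : ℝ → ℝ := fun t => (Y * NormedSpace.exp (𝔄 + t • Y)).trace.re with hNdef
  have hHt : ∀ t : ℝ, (H - (t : ℂ) • A).IsHermitian := fun t => isHermitian_sub_smul hH hA t
  have hgW : ∀ t : ℝ, gibbsWeight β (H - (t : ℂ) • A) = NormedSpace.exp (𝔄 + t • Y) := fun t =>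
    gibbsWeight_sub_smul β H A t
  have hZt : ∀ t : ℝ, Z t = (partitionFn β (H - (t : ℂ) • A)).re := by
    intro t
    simp only [hZdef, partitionFn, hgW]
  have hZpos : ∀ t, 0 < Z t := fun t => by rw [hZt]; exact partitionFn_re_pos (hHt t) β
  have hm : ∀ t : ℝ, (gibbsState β (H - (t : ℂ) • A) A).re = β⁻¹ * (N t / Z t) := by
    intro t
    have hZne : Z t ≠ 0 := (hZpos t).ne'
    have hZc : partitionFn β (H - (t : ℂ) • A) = ((Z t : ℝ) : ℂ) := by
      rw [hZt]; exact partitionFn_eq_re (hHt t) β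
    have hN : N t = β * (A * NormedSpace.exp (𝔄 + t • Y)).trace.re := by
      simp only [hNdef, hY, Matrix.smul_mul, trace_smul, smul_eq_mul, Complex.re_ofReal_mul]
    rw [gibbsState_apply, hZc, ← Complex.ofReal_inv, Complex.re_ofReal_mul, trace_mul_comm, hgW,
      hN]
    field_simp
  have hZ' : HasDerivAt Z (N s) s := hasDerivAt_re_trace_exp_add_smul 𝔄 Y s
  have hlog : HasDerivAt (fun t => Real.log (Z t)) (N s / Z s) s := hZ'.log (hZpos s).ne'
  have hfun : (fun t : ℝ => Real.log (partitionFn β (H - (t : ℂ) • A)).re) = fun t => Real.log (Z t) :=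
    funext fun t => by rw [hZt]
  rw [hfun]
  refine hlog.congr_deriv ?_
  rw [hm s]
  field_simp

/-- **Two-sided gain comparison from a variance comparison** (two mean value theorems). For Hermitian
`H₁, H₂, A` with `⟨A⟩_{H₁} = ⟨A⟩_{H₂} = 0`, `β > 0` and a real `h`: if the KMB variances of `A` along
the sourced families `H_i − tA` differ by at most `v` for `|t| ≤ |h|`, then
`|[log Z(H₁ − hA) − log Z(H₁)] − [log Z(H₂ − hA) − log Z(H₂)]| ≤ β² v h²`. [cite: DLS1978, §3 eq. (5)] -/
theorem abs_gainCorrection_le_of_varDiff_le {H₁ H₂ A : Matrix m m ℂ} (hH₁ : H₁.IsHermitian)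
    (hH₂ : H₂.IsHermitian) (hA : A.IsHermitian) [Nonempty m] {β : ℝ} (hβ : 0 < β)
    (h01 : (gibbsState β H₁ A).re = 0) (h02 : (gibbsState β H₂ A).re = 0) {h v : ℝ}
    (hv : ∀ t : ℝ, |t| ≤ |h| →
      |((duhamel β (H₁ - (t : ℂ) • A) A A).re - (gibbsState β (H₁ - (t : ℂ) • A) A).re ^ 2) -
        ((duhamel β (H₂ - (t : ℂ) • A) A A).re - (gibbsState β (H₂ - (t : ℂ) • A) A).re ^ 2)| ≤ v) :
    |(Real.log (partitionFn β (H₁ - (h : ℂ) • A)).re - Real.log (partitionFn β H₁).re) -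
        (Real.log (partitionFn β (H₂ - (h : ℂ) • A)).re - Real.log (partitionFn β H₂).re)| ≤
      β ^ 2 * v * h ^ 2 := by
  -- the difference function, its first and second derivatives
  set F : ℝ → ℝ := fun t => Real.log (partitionFn β (H₁ - (t : ℂ) • A)).re -
    Real.log (partitionFn β (H₂ - (t : ℂ) • A)).re with hFdef
  set F' : ℝ → ℝ := fun t => β * (gibbsState β (H₁ - (t : ℂ) • A) A).re -
    β * (gibbsState β (H₂ - (t : ℂ) • A) A).re with hF'def
  set F'' : ℝ → ℝ := fun t =>
    β * (β * ((duhamel β (H₁ - (t : ℂ) • A) A A).re - (gibbsState β (H₁ - (t : ℂ) • A) A).re ^ 2)) -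
    β * (β * ((duhamel β (H₂ - (t : ℂ) • A) A A).re - (gibbsState β (H₂ - (t : ℂ) • A) A).re ^ 2))
    with hF''def
  have hd1 : ∀ t, HasDerivAt F (F' t) t := fun t =>
    (hasDerivAt_log_partitionFn_source hH₁ hA hβ t).sub (hasDerivAt_log_partitionFn_source hH₂ hA hβ t)
  have hd2 : ∀ t, HasDerivAt F' (F'' t) t := fun t =>
    ((hasDerivAt_re_gibbsState_source hH₁ hA hβ t).const_mul β).sub
      ((hasDerivAt_re_gibbsState_source hH₂ hA hβ t).const_mul β)
  have hF0 : F 0 = Real.log (partitionFn β H₁).re - Real.log (partitionFn β H₂).re := by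
    simp [hFdef]
  have hF'0 : F' 0 = 0 := by
    simp [hF'def, h01, h02]
  have hF''le : ∀ t, |t| ≤ |h| → |F'' t| ≤ β ^ 2 * v := by
    intro t ht
    have e : F'' t = β ^ 2 *
        (((duhamel β (H₁ - (t : ℂ) • A) A A).re - (gibbsState β (H₁ - (t : ℂ) • A) A).re ^ 2) -
          ((duhamel β (H₂ - (t : ℂ) • A) A A).re - (gibbsState β (H₂ - (t : ℂ) • A) A).re ^ 2)) := by
      simp only [hF''def]; ring
    rw [e, abs_mul, abs_of_nonneg (by positivity : (0 : ℝ) ≤ β ^ 2)]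
    exact mul_le_mul_of_nonneg_left (hv t ht) (by positivity)
  -- the claim is about F h − F 0
  have hgoal : (Real.log (partitionFn β (H₁ - (h : ℂ) • A)).re - Real.log (partitionFn β H₁).re) -
      (Real.log (partitionFn β (H₂ - (h : ℂ) • A)).re - Real.log (partitionFn β H₂).re) = F h - F 0 := by
    rw [hF0]; simp only [hFdef]; ring
  rw [hgoal]
  -- two mean value theorems on the segment between 0 and h
  have key : ∀ {a b : ℝ}, a < b → (a = 0 ∨ b = 0) → |a| ≤ |h| → |b| ≤ |h| →
      |F b - F a| ≤ β ^ 2 * v * h ^ 2 := by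
    intro a b hab h0 ha hb
    obtain ⟨ξ, hξ, hslope⟩ := exists_hasDerivAt_eq_slope F F' hab
      (fun t _ => (hd1 t).continuousAt.continuousWithinAt) (fun t _ => hd1 t)
    have hξabs : |ξ| ≤ |h| := by
      rw [abs_le] at ha hb ⊢
      constructor <;> nlinarith [hξ.1, hξ.2, ha.1, hb.2]
    have hFba : F b - F a = F' ξ * (b - a) := by
      rw [hslope]; field_simp [(sub_pos.mpr hab).ne']
    -- second MVT between 0 and ξ
    have hF'ξ : |F' ξ| ≤ β ^ 2 * v * |ξ| := by
      rcases lt_trichotomy ξ 0 with hneg | hzero | hpos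
      · obtain ⟨ζ, hζ, hslope2⟩ := exists_hasDerivAt_eq_slope F' F'' hneg
          (fun t _ => (hd2 t).continuousAt.continuousWithinAt) (fun t _ => hd2 t)
        have hζabs : |ζ| ≤ |h| := by
          rw [abs_le] at hξabs ⊢
          constructor <;> nlinarith [hζ.1, hζ.2, hξabs.1]
        have e2 : F' ξ = F'' ζ * ξ := by
          rw [hslope2, hF'0, zero_sub, zero_sub, neg_div_neg_eq]; field_simp [hneg.ne]
        rw [e2, abs_mul]
        exact mul_le_mul_of_nonneg_right (hF''le ζ hζabs) (abs_nonneg ξ)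
      · rw [hzero, hF'0, abs_zero, mul_zero]
      · obtain ⟨ζ, hζ, hslope2⟩ := exists_hasDerivAt_eq_slope F' F'' hpos
          (fun t _ => (hd2 t).continuousAt.continuousWithinAt) (fun t _ => hd2 t)
        have hζabs : |ζ| ≤ |h| := by
          rw [abs_le] at hξabs ⊢
          constructor <;> nlinarith [hζ.1, hζ.2, hξabs.2]
        have e2 : F' ξ = F'' ζ * ξ := by
          rw [hslope2, hF'0, sub_zero, sub_zero]; field_simp [hpos.ne']
        rw [e2, abs_mul]
        exact mul_le_mul_of_nonneg_right (hF''le ζ hζabs) (abs_nonneg ξ)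
    have hba : |b - a| ≤ |h| := by
      rcases h0 with rfl | rfl
      · simpa using hb
      · simpa [abs_sub_comm] using ha
    rw [hFba, abs_mul]
    have hvnn : 0 ≤ β ^ 2 * v := by
      have := hF''le 0 (by simp)
      exact (abs_nonneg _).trans this
    calc |F' ξ| * |b - a| ≤ (β ^ 2 * v * |ξ|) * |h| :=
          mul_le_mul hF'ξ hba (abs_nonneg _) (by positivity)
      _ ≤ (β ^ 2 * v * |h|) * |h| := by
          have := mul_le_mul_of_nonneg_left hξabs hvnn
          exact mul_le_mul_of_nonneg_right this (abs_nonneg h)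
      _ = β ^ 2 * v * h ^ 2 := by rw [← sq_abs h]; ring
  rcases lt_trichotomy h 0 with hneg | hzero | hpos
  · have := key hneg (Or.inr rfl) le_rfl (by simp)
    rwa [abs_sub_comm] at this
  · subst hzero; simp
  · exact key hpos (Or.inl rfl) (by simp) le_rfl

end Abstract

/-! ### The torus: susceptibility difference on the disc ⇒ two-sided disc slack -/

section Torus

variable (L : ℕ) [NeZero L]

/-- **Two-sided disc slack from a susceptibility comparison.** For `β > 0`, every `L ≥ 1`, all
`U, μ` and a real source `h`: if the per-site KMB pair susceptibilities of the interacting and of the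
free sourced torus differ by at most `M` for all `|t| ≤ |h|`, then
`|[p̃_U(h) − p̃_0(h)] − [p̃_U(0) − p̃_0(0)]| ≤ M h²`. [cite: DLS1978, §3 eq. (5)] -/
theorem tw_discSlack_of_susceptibilityDiff_le {β : ℝ} (hβ : 0 < β) (U μ : ℝ) {h M : ℝ}
    (hM : ∀ t : ℝ, |t| ≤ |h| →
      |β / (L : ℝ) ^ 2 *
          ((duhamel β (dWaveSourceTorus L U μ t)
              (pairField dWaveFormFactor L + (pairField dWaveFormFactor L)ᴴ)
              (pairField dWaveFormFactor L + (pairField dWaveFormFactor L)ᴴ)).re -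
            (gibbsState β (dWaveSourceTorus L U μ t)
              (pairField dWaveFormFactor L + (pairField dWaveFormFactor L)ᴴ)).re ^ 2) -
        β / (L : ℝ) ^ 2 *
          ((duhamel β (dWaveSourceTorus L 0 μ t)
              (pairField dWaveFormFactor L + (pairField dWaveFormFactor L)ᴴ)
              (pairField dWaveFormFactor L + (pairField dWaveFormFactor L)ᴴ)).re -
            (gibbsState β (dWaveSourceTorus L 0 μ t)
              (pairField dWaveFormFactor L + (pairField dWaveFormFactor L)ᴴ)).re ^ 2)| ≤ M) :
    |(Real.log (partitionFn β (dWaveSourceTorus L U μ h)).re / (β * (L : ℝ) ^ 2) -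
        Real.log (partitionFn β (dWaveSourceTorus L 0 μ h)).re / (β * (L : ℝ) ^ 2)) -
      (Real.log (partitionFn β (dWaveSourceTorus L U μ 0)).re / (β * (L : ℝ) ^ 2) -
        Real.log (partitionFn β (dWaveSourceTorus L 0 μ 0)).re / (β * (L : ℝ) ^ 2))| ≤
      M * h ^ 2 := by
  set Q := pairField dWaveFormFactor L + (pairField dWaveFormFactor L)ᴴ with hQdef
  have hL : (0 : ℝ) < (L : ℝ) ^ 2 := cast_sq_pos_of_neZero L
  have hden : 0 < β * (L : ℝ) ^ 2 := mul_pos hβ hL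
  have hHU := isHermitian_hubbardTorusWith L 1 U μ
  have hH0 := isHermitian_hubbardTorusWith L 1 0 μ
  have hQ : Q.IsHermitian := isHermitian_pairField_add_conjTranspose L
  have h0U : (gibbsState β (hubbardTorusWith 2 L 1 U μ) Q).re = 0 := by
    rw [hQdef, gibbsState_hubbardTorusWith_pairSource, Complex.zero_re]
  have h00 : (gibbsState β (hubbardTorusWith 2 L 1 0 μ) Q).re = 0 := by
    rw [hQdef, gibbsState_hubbardTorusWith_pairSource, Complex.zero_re]
  have hKt : ∀ (u t : ℝ), dWaveSourceTorus L u μ t = hubbardTorusWith 2 L 1 u μ - (t : ℂ) • Q :=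
    fun u t => rfl
  have hK0 : ∀ u : ℝ, dWaveSourceTorus L u μ 0 = hubbardTorusWith 2 L 1 u μ := fun u =>
    dWaveSourceTorus_zero L u μ
  -- variance comparison in un-normalised units: v = M L²/β
  have hv : ∀ t : ℝ, |t| ≤ |h| →
      |((duhamel β (hubbardTorusWith 2 L 1 U μ - (t : ℂ) • Q) Q Q).re -
          (gibbsState β (hubbardTorusWith 2 L 1 U μ - (t : ℂ) • Q) Q).re ^ 2) -
        ((duhamel β (hubbardTorusWith 2 L 1 0 μ - (t : ℂ) • Q) Q Q).re -
          (gibbsState β (hubbardTorusWith 2 L 1 0 μ - (t : ℂ) • Q) Q).re ^ 2)| ≤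
        M * (L : ℝ) ^ 2 / β := by
    intro t ht
    have h1 := hM t ht
    rw [← hKt U t, ← hKt 0 t]
    rw [← mul_sub, abs_mul, abs_of_pos (div_pos hβ hL), div_mul_eq_mul_div, div_le_iff₀ hL] at h1
    rw [le_div_iff₀ hβ]
    linarith [h1]
  have hmain := abs_gainCorrection_le_of_varDiff_le hHU hH0 hQ hβ h0U h00 hv
  rw [← hKt U h, ← hKt 0 h, ← hK0 U, ← hK0 0] at hmain
  -- divide by βL²
  have e1 : (Real.log (partitionFn β (dWaveSourceTorus L U μ h)).re / (β * (L : ℝ) ^ 2) -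
        Real.log (partitionFn β (dWaveSourceTorus L 0 μ h)).re / (β * (L : ℝ) ^ 2)) -
      (Real.log (partitionFn β (dWaveSourceTorus L U μ 0)).re / (β * (L : ℝ) ^ 2) -
        Real.log (partitionFn β (dWaveSourceTorus L 0 μ 0)).re / (β * (L : ℝ) ^ 2)) =
      ((Real.log (partitionFn β (dWaveSourceTorus L U μ h)).re -
          Real.log (partitionFn β (dWaveSourceTorus L U μ 0)).re) -
        (Real.log (partitionFn β (dWaveSourceTorus L 0 μ h)).re -
          Real.log (partitionFn β (dWaveSourceTorus L 0 μ 0)).re)) / (β * (L : ℝ) ^ 2) := by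
    field_simp
    ring
  rw [e1, abs_div, abs_of_pos hden, div_le_iff₀ hden]
  calc |(Real.log (partitionFn β (dWaveSourceTorus L U μ h)).re -
          Real.log (partitionFn β (dWaveSourceTorus L U μ 0)).re) -
        (Real.log (partitionFn β (dWaveSourceTorus L 0 μ h)).re -
          Real.log (partitionFn β (dWaveSourceTorus L 0 μ 0)).re)|
      ≤ β ^ 2 * (M * (L : ℝ) ^ 2 / β) * h ^ 2 := hmain
    _ = M * h ^ 2 * (β * (L : ℝ) ^ 2) := by field_simp

/-- **The engine stub (A) in susceptibility form ⇒ (A) verbatim** (registered stub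
`stub_engineDiscSlack` of crux item stmt-HubbardSuperconductivity-1697; same `κ, U₀, a, K`): the
two-sided comparison `|χ_L(β,U,μ,t) − χ_L(β,0,μ,t)| ≤ η log β + K` of the interacting and free KMB
`d`-wave pair susceptibilities throughout the disc `|t| ≤ κ/β` integrates (twice) to the two-sided
disc slack of the sourced gain. [cite: BenfattoGiulianiMastropietro2006, Thm 1.1 and Remark 2] -/
theorem stub_engineDiscSlack_of_susceptibilitySlack :
    (∀ μ₁ μ₂ : ℝ, -4 < μ₁ → μ₁ ≤ μ₂ → μ₂ < 0 → ∃ κ : ℝ, 0 < κ ∧ ∀ η : ℝ, 0 < η →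
      ∃ U₀ a K : ℝ, 0 < U₀ ∧ 0 < a ∧ 0 < K ∧ ∀ U : ℝ, 0 < U → U ≤ U₀ →
      ∀ β : ℝ, 1 ≤ β → β ≤ Real.exp (a / U) → ∀ μ ∈ Set.Icc μ₁ μ₂, ∃ L₀ : ℕ,
      ∀ (L : ℕ) [NeZero L], L₀ ≤ L → ∀ t : ℝ, |t| ≤ κ / β →
        |β / (L : ℝ) ^ 2 *
            ((Matrix.duhamel β (Literature.MathematicalPhysics.QuantumLattice.dWaveSourceTorus L U μ t)
              (Literature.MathematicalPhysics.QuantumLattice.pairField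
                Literature.MathematicalPhysics.QuantumLattice.dWaveFormFactor L +
              (Literature.MathematicalPhysics.QuantumLattice.pairField
                Literature.MathematicalPhysics.QuantumLattice.dWaveFormFactor L)ᴴ)
              (Literature.MathematicalPhysics.QuantumLattice.pairField
                Literature.MathematicalPhysics.QuantumLattice.dWaveFormFactor L +
              (Literature.MathematicalPhysics.QuantumLattice.pairField
                Literature.MathematicalPhysics.QuantumLattice.dWaveFormFactor L)ᴴ)).re -
             (Matrix.gibbsState β (Literature.MathematicalPhysics.QuantumLattice.dWaveSourceTorus L U μ t)
              (Literature.MathematicalPhysics.QuantumLattice.pairField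
                Literature.MathematicalPhysics.QuantumLattice.dWaveFormFactor L +
              (Literature.MathematicalPhysics.QuantumLattice.pairField
                Literature.MathematicalPhysics.QuantumLattice.dWaveFormFactor L)ᴴ)).re ^ 2) -
          β / (L : ℝ) ^ 2 *
            ((Matrix.duhamel β (Literature.MathematicalPhysics.QuantumLattice.dWaveSourceTorus L 0 μ t)
              (Literature.MathematicalPhysics.QuantumLattice.pairField
                Literature.MathematicalPhysics.QuantumLattice.dWaveFormFactor L +
              (Literature.MathematicalPhysics.QuantumLattice.pairField
                Literature.MathematicalPhysics.QuantumLattice.dWaveFormFactor L)ᴴ)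
              (Literature.MathematicalPhysics.QuantumLattice.pairField
                Literature.MathematicalPhysics.QuantumLattice.dWaveFormFactor L +
              (Literature.MathematicalPhysics.QuantumLattice.pairField
                Literature.MathematicalPhysics.QuantumLattice.dWaveFormFactor L)ᴴ)).re -
             (Matrix.gibbsState β (Literature.MathematicalPhysics.QuantumLattice.dWaveSourceTorus L 0 μ t)
              (Literature.MathematicalPhysics.QuantumLattice.pairField
                Literature.MathematicalPhysics.QuantumLattice.dWaveFormFactor L +
              (Literature.MathematicalPhysics.QuantumLattice.pairField
                Literature.MathematicalPhysics.QuantumLattice.dWaveFormFactor L)ᴴ)).re ^ 2)| ≤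
        η * Real.log β + K) →
    (∀ μ₁ μ₂ : ℝ, -4 < μ₁ → μ₁ ≤ μ₂ → μ₂ < 0 → ∃ κ : ℝ, 0 < κ ∧ ∀ η : ℝ, 0 < η →
      ∃ U₀ a K : ℝ, 0 < U₀ ∧ 0 < a ∧ 0 < K ∧ ∀ U : ℝ, 0 < U → U ≤ U₀ →
      ∀ β : ℝ, 1 ≤ β → β ≤ Real.exp (a / U) → ∀ μ ∈ Set.Icc μ₁ μ₂, ∃ L₀ : ℕ,
      ∀ (L : ℕ) [NeZero L], L₀ ≤ L → ∀ h : ℝ, |h| ≤ κ / β →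
        |(Real.log (Matrix.partitionFn β
            (Literature.MathematicalPhysics.QuantumLattice.dWaveSourceTorus L U μ h)).re /
            (β * (L : ℝ) ^ 2) -
            Real.log (Matrix.partitionFn β
            (Literature.MathematicalPhysics.QuantumLattice.dWaveSourceTorus L 0 μ h)).re /
            (β * (L : ℝ) ^ 2)) -
          (Real.log (Matrix.partitionFn β
            (Literature.MathematicalPhysics.QuantumLattice.dWaveSourceTorus L U μ 0)).re /
            (β * (L : ℝ) ^ 2) -
            Real.log (Matrix.partitionFn β
            (Literature.MathematicalPhysics.QuantumLattice.dWaveSourceTorus L 0 μ 0)).re /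
            (β * (L : ℝ) ^ 2))| ≤
        (η * Real.log β + K) * h ^ 2) := by
  intro H μ₁ μ₂ h4 h12 h0
  obtain ⟨κ, hκ, Hη⟩ := H μ₁ μ₂ h4 h12 h0
  refine ⟨κ, hκ, fun η hη => ?_⟩
  obtain ⟨U₀, a, K, hU₀, ha, hK, hmain⟩ := Hη η hη
  refine ⟨U₀, a, K, hU₀, ha, hK, fun U hU hUU₀ β hβ hβa μ hμ => ?_⟩
  obtain ⟨L₀, hL₀⟩ := hmain U hU hUU₀ β hβ hβa μ hμ
  refine ⟨L₀, fun L _ hL h hh => ?_⟩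
  have hβpos : 0 < β := lt_of_lt_of_le one_pos hβ
  exact tw_discSlack_of_susceptibilityDiff_le L hβpos U μ
    (fun t ht => hL₀ L hL t (ht.trans hh))

end Torus

end Summit.HubbardSuperconductivity.HubbardSuperconductivity.Theorems
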